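import Literature.NumberTheory.LFunctions.Zhang2022.DHMenuConsistentStripCount
import Literature.NumberTheory.LFunctions.Zhang2022.DHMenuConsistentRow04Low
import Literature.NumberTheory.LFunctions.CriticalZerosDirichletFamilySono
import HarnessLib

/-!
# B-DH-W, the INFORMAL rows, part 2: `Zhang2022.DH.MenuInformalCritLineConsistent` — the critical-line
# PROPORTION rows of dhE-14 rendered over the (A)-world with thresholds UNIFORM in `D`, and PROVED
# (cell `landau-siegel`, family B-dh KILLED; §E item S-E-bd1-3 part 2, ls-barrier-plan g1 2026-08-26T22:26:24Z; REF-E E-18c)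

Topic `Literature/NumberTheory/LFunctions/Zhang2022` (namespace `Literature.NumberTheory.LFunctions.Zhang2022.DH`), companion
of `DHMenuConsistentInformal.lean` (part 1, p475376: the zero-density / zero-free rows of `M_informal` with inexplicit
constants — `MenuInformalConsistent`, PROVED). CONSISTENCY-MODEL CURRENCY (director-frontier g6 2026-08-26T19:31:07Z): EDLIST
row dhE-14 («CRITLINE-zeros: infinitely many (positive proportion) zeros of primitive `L(s,χ)` on `Re s = ½`», KILL-draft
v1.4.5 §1: in `M_informal`, «met by W⁺ by inspection: the fence») is TYPED in the tree by three named facts about PROPORTIONS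
of critical zeros; this file renders those three decls VERBATIM over the world's zero data and proves them on `W(D, χ)`
with the thresholds chosen ONCE, before `D`. Together with part 1 this covers the typed part of `M_informal`; it says
nothing about untyped rows and nothing about any actual `L`-function.

## What is typed (statement) and proved (theorem)

`ZeroWorld.MenuInformalCritLine Q₀ Q₁ T₀` — one field per typed dhE-14 decl, its statement read verbatim on the world
(`L(ρ,χ) = 0 ∧ 0 < Re ρ < 1` = `ExplicitPsiChar.charNontrivialZeros` ↦ `w.nontrivialZeros`; `zeroOrder ↦ w.mult`; the sources'
counting objects rebuilt verbatim in §1), the sources' thresholds `∃ Q₀` (depending on the weight and on `A`) / `∃ T₀`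
(depending on `g`) Skolemised into the parameters and re-quantified ONCE before `∀ D` in `MenuInformalCritLineConsistent`:
* `rowCIS1` ↔ `Literature.NumberTheory.LFunctions.conreyIwaniecSoundararajanCriticalZeros_theorem1` (Conrey–Iwaniec–
  Soundararajan, Theorem 1 (1.5): `𝒩₀′(T,Q) ≥ (14/25)𝒩(T,Q)` for `Q ≥ Q₀(Ψ,A)`, `(log Q)⁶ ≤ T ≤ (log Q)^A`; family sum
  `Σ_q Ψ(q/Q)φ(q)⁻¹ Σ*_{χ (mod q)}`, window `|γ| ≤ T`, `N₀′` = SIMPLE zeros on `Re s = ½` counted once);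
* `rowSono` ↔ `Literature.NumberTheory.LFunctions.sono2025_theorem11` (Sono 2025, Thm 1.1: `𝒩₀′ ≥ 0.6044·𝒩` and
  `𝒩₀ ≥ 0.6107·𝒩` for `Q ≥ Q₀(W,A)`, `(log Q)² ≤ T ≤ (log Q)^A`; family `Σ_q W(q/Q) Σ♭` over EVEN primitive characters,
  DYADIC window `T ≤ γ < 2T`);
* `rowWu` ↔ `Literature.NumberTheory.LFunctions.wu2019_theorem2` (Wu 2019, Thm 2: for `g(T) = o(log T)` there is `T₀(g)` with
  `N₀(T,χ) ≥ 0.4172·N(T,χ)` and `N₀*(T,χ) ≥ 0.4074·N(T,χ)` for every `χ` mod `q`, `log q ≤ g(T)`, `T ≥ T₀`; single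
  character, window `|γ| ≤ T`).
THE THEOREM `menuInformalCritLineConsistent_holds` with the witnesses `Q₀ ≡ Q₁ ≡ 3`, `T₀ ≡ 1`: in `W(D,χ)` every zero of a
slot with `0 < Re ρ < 1` is a point of the conductor's picket fence (simple, on the line) or, on the induced slots only, one
of the two simple REAL zeros `β₁, 1 − β₁` (`Im = 0`). Hence per slot `N = 2F + 2·[induced]` (`stripCount_world_of_exc` /
`_of_not_exc`, ls-barrier-p4), `N₀ = N₀′ = N₀* = 2F` (`F = fenceCount (cond ψ) T`), and the proportion rows hold because an
induced slot has conductor `D` and `F = fenceCount D T ≥ 2` for `T ≥ 1` (`two_le_fenceCount_self`: `log(D/2πe) ≥ 43 247`):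
`(14/25)(2F + 2) ≤ 2F`, `0.4172(2F + 2) ≤ 2F`; Sono's dyadic window `T ≤ γ < 2T` excludes the real pair outright, so there
`N = N₀ = N₀′` slot by slot. The family sums are `finsum`s with finitely many non-zero terms (the weights are compactly
supported), compared termwise (`weighted_finsum_le`).
NOT RENDERED, with reasons (scope): `conreyIwaniecSoundararajanCriticalZeros_theorem2` is a MOLLIFIED-MOMENT asymptotic (no
zero data); `conreyIwaniecSoundararajanCriticalZeros_levinsonBound` asserts `(κ′ − ε)𝒩 ≤ 𝒩₀′` for every `θ, r, R` with
`c(θ,r,R) > 0`, and its consistency with ANY zero world needs `κ′ ≤ 1`, i.e. `c(θ,r,R) ≥ 1` — true as a consequence of the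
source's theorems but not a tree fact (not a typing defect; simply not renderable here); dhE-18(ii) (Granville–Soundararajan
large values of `|L(1,χ)|`) is untyped AND would need the KILL-draft A1 value profile (this world's value field is the minimal
`LOne ∈ {λ, 1}`), i.e. a different world; dhE-20 (Selberg) untyped.

WHAT THIS IS NOT: not a change to E-057's frozen text; not a statement about untyped rows; no `L`-function; no verdict.
«The programme SEARCHES and TYPES; no claim about Landau–Siegel zeros, Theorems 1–2 of arXiv:2211.02515 or a repaired Margin232
until a kernel theorem says so.»

## References

* `pub/landau-siegel/B-dh/EDLIST.md` v1.5 row dhE-14 (= E-047), `B-dh/KILL-draft.md` v1.4.5 §1 (M_informal), ls-barrier-plan g1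
  INBOX 2026-08-26T22:26:24Z (3) (item S-E-bd1-3, «(d) onward»).
* [ConreyIwaniecSoundararajan2011CriticalZeros] Theorem 1 (1.5); [Sono2025] Theorem 1.1; [Wu2019TwistedMeanSquare] Theorem 2;
  [BennettMartinOBryantRechnitzer2021] Theorem 1.1 (the fence count); [Zhang2022LandauSiegel] §2 Assumption (A).
-/

noncomputable section

open scoped Classical
open Complex Filter Topology

namespace Literature.NumberTheory.LFunctions.Zhang2022.DH

/-! ## 1. The sources' counting objects, rebuilt verbatim over a zero world -/

namespace ZeroWorld

variable (w : ZeroWorld)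

/-- The non-trivial zeros of a slot: `L(ρ,χ) = 0` with `0 < Re ρ < 1` over the world
(= `ExplicitPsiChar.charNontrivialZeros`). [cite: MontgomeryVaughan2007, Corollary 10.8] -/
def nontrivialZeros (q : ℕ) (χ : DirichletCharacter ℂ q) : Set ℂ :=
  {ρ | w.IsZero q χ ρ ∧ 0 < ρ.re ∧ ρ.re < 1}

/-- `N(T,χ)` of Conrey–Iwaniec–Soundararajan over the world (= `CISCriticalZeros.zeroCount`: multiplicities summed over the
non-trivial zeros with `|Im ρ| ≤ T`). [cite: ConreyIwaniecSoundararajan2011CriticalZeros, §1 (1.2) (definition of N(T,χ))] -/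
def cisZeroCount (q : ℕ) (χ : DirichletCharacter ℂ q) (T : ℝ) : ℕ :=
  ∑ᶠ ρ ∈ {ρ : ℂ | ρ ∈ w.nontrivialZeros q χ ∧ |ρ.im| ≤ T}, w.mult q χ ρ

/-- `N₀′(T,χ)` of Conrey–Iwaniec–Soundararajan over the world (= `CISCriticalZeros.simpleCriticalZeroCount`: the SIMPLE
zeros `½ + iγ`, `|γ| ≤ T`, each once). [cite: ConreyIwaniecSoundararajan2011CriticalZeros, §1 (definition of N₀′(T,χ))] -/
def cisSimpleCriticalZeroCount (q : ℕ) (χ : DirichletCharacter ℂ q) (T : ℝ) : ℕ :=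
  Set.ncard {ρ : ℂ | ρ ∈ w.nontrivialZeros q χ ∧ ρ.re = 1 / 2 ∧ |ρ.im| ≤ T ∧ w.mult q χ ρ = 1}

/-- `N₀(T,χ)` of Wu over the world (= `WuCriticalZeros.criticalZeroCount`: zeros `½ + iγ′`, `|γ′| ≤ T`, WITH multiplicity).
[cite: Wu2019TwistedMeanSquare, §1 (definition of N₀(T,χ), before Thm 2)] -/
def wuCriticalZeroCount (q : ℕ) (χ : DirichletCharacter ℂ q) (T : ℝ) : ℕ :=
  ∑ᶠ ρ ∈ {ρ : ℂ | ρ ∈ w.nontrivialZeros q χ ∧ ρ.re = 1 / 2 ∧ |ρ.im| ≤ T}, w.mult q χ ρ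

/-- `N(T,χ)` of Sono over the world (= `SonoCriticalZeros.zeroCount`: dyadic window `T ≤ γ < 2T`, with multiplicity).
[cite: Sono2025, §1 (definition of N(T,χ))] -/
def sonoZeroCount (q : ℕ) (χ : DirichletCharacter ℂ q) (T : ℝ) : ℕ :=
  ∑ᶠ ρ ∈ {ρ : ℂ | ρ ∈ w.nontrivialZeros q χ ∧ T ≤ ρ.im ∧ ρ.im < 2 * T}, w.mult q χ ρ

/-- `N₀(T,χ)` of Sono over the world (= `SonoCriticalZeros.criticalZeroCount`). [cite: Sono2025, §1 (definition of N₀(T,χ))] -/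
def sonoCriticalZeroCount (q : ℕ) (χ : DirichletCharacter ℂ q) (T : ℝ) : ℕ :=
  ∑ᶠ ρ ∈ {ρ : ℂ | ρ ∈ w.nontrivialZeros q χ ∧ ρ.re = 1 / 2 ∧ T ≤ ρ.im ∧ ρ.im < 2 * T}, w.mult q χ ρ

/-- `N₀′(T,χ)` of Sono over the world (= `SonoCriticalZeros.simpleCriticalZeroCount`). [cite: Sono2025, §1 (definition of N₀′(T,χ))] -/
def sonoSimpleCriticalZeroCount (q : ℕ) (χ : DirichletCharacter ℂ q) (T : ℝ) : ℕ :=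
  Set.ncard {ρ : ℂ | ρ ∈ w.nontrivialZeros q χ ∧ ρ.re = 1 / 2 ∧ T ≤ ρ.im ∧ ρ.im < 2 * T ∧ w.mult q χ ρ = 1}

/-- `𝒩(T,Q) = Σ_q Ψ(q/Q) φ(q)⁻¹ Σ*_{χ (mod q)} N(T,χ)` over the world (= `CISCriticalZeros.familyZeroCount`).
[cite: ConreyIwaniecSoundararajan2011CriticalZeros, §1 (1.4)] -/
def cisFamilyZeroCount (Ψ : ℝ → ℝ) (Q T : ℝ) : ℝ :=
  ∑ᶠ k : ℕ, Ψ (((k + 1 : ℕ) : ℝ) / Q) / (Nat.totient (k + 1) : ℝ) *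
    ∑ χ : DirichletCharacter ℂ (k + 1) with χ.IsPrimitive, (w.cisZeroCount (k + 1) χ T : ℝ)

/-- `𝒩₀′(T,Q)` over the world (= `CISCriticalZeros.familySimpleCriticalZeroCount`).
[cite: ConreyIwaniecSoundararajan2011CriticalZeros, §1 (after (1.4))] -/
def cisFamilySimpleCriticalZeroCount (Ψ : ℝ → ℝ) (Q T : ℝ) : ℝ :=
  ∑ᶠ k : ℕ, Ψ (((k + 1 : ℕ) : ℝ) / Q) / (Nat.totient (k + 1) : ℝ) *
    ∑ χ : DirichletCharacter ℂ (k + 1) with χ.IsPrimitive, (w.cisSimpleCriticalZeroCount (k + 1) χ T : ℝ)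

/-- `𝒩(T,Q)` of Sono over the world (= `SonoCriticalZeros.familyZeroCount`; the family-sum operator `Σ_q W(q/Q) Σ♭`
is the source's own `SonoCriticalZeros.evenFamilySum`, reused). [cite: Sono2025, §1 (1.5)] -/
def sonoFamilyZeroCount (W : ℝ → ℝ) (Q T : ℝ) : ℝ :=
  SonoCriticalZeros.evenFamilySum W Q fun k χ ↦ (w.sonoZeroCount (k + 1) χ T : ℝ)

/-- `𝒩₀(T,Q)` of Sono over the world (= `SonoCriticalZeros.familyCriticalZeroCount`). [cite: Sono2025, §1 (after (1.5))] -/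
def sonoFamilyCriticalZeroCount (W : ℝ → ℝ) (Q T : ℝ) : ℝ :=
  SonoCriticalZeros.evenFamilySum W Q fun k χ ↦ (w.sonoCriticalZeroCount (k + 1) χ T : ℝ)

/-- `𝒩₀′(T,Q)` of Sono over the world (= `SonoCriticalZeros.familySimpleCriticalZeroCount`). [cite: Sono2025, §1 (after (1.5))] -/
def sonoFamilySimpleCriticalZeroCount (W : ℝ → ℝ) (Q T : ℝ) : ℝ :=
  SonoCriticalZeros.evenFamilySum W Q fun k χ ↦ (w.sonoSimpleCriticalZeroCount (k + 1) χ T : ℝ)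

/-! ## 2. The critical-line informal menu and the certificate statement -/

/-- **THE CRITICAL-LINE INFORMAL MENU over a world**, thresholds as PARAMETERS (quantified ONCE, before `∀ D`, in
`MenuInformalCritLineConsistent`): one field per typed proportion decl of dhE-14, read verbatim on the world's zero data.
[cite: Zhang2022LandauSiegel, §2 Assumption (A)] -/
structure MenuInformalCritLine (Q₀ Q₁ : (ℝ → ℝ) → ℝ → ℝ) (T₀ : (ℝ → ℝ) → ℝ) : Prop where
  /-- dhE-14 / CIS Thm 1 = `conreyIwaniecSoundararajanCriticalZeros_theorem1` (its `∃ Q₀` for each `Ψ, A` is `Q₀ Ψ A`). -/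
  rowCIS1 : ∀ Ψ : ℝ → ℝ, CISCriticalZeros.IsNonnegFamilyWeight Ψ → ∀ A : ℝ, 6 ≤ A →
    ∀ Q T : ℝ, Q₀ Ψ A ≤ Q → Real.log Q ^ (6 : ℝ) ≤ T → T ≤ Real.log Q ^ A →
      (14 / 25 : ℝ) * w.cisFamilyZeroCount Ψ Q T ≤ w.cisFamilySimpleCriticalZeroCount Ψ Q T
  /-- dhE-14 / Sono Thm 1.1 = `sono2025_theorem11` (its `∃ Q₀` for each `W, A` is `Q₁ W A`). -/
  rowSono : ∀ W : ℝ → ℝ, SonoCriticalZeros.IsSonoWeight W → ∀ A : ℝ, 2 < A →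
    ∀ Q T : ℝ, Q₁ W A ≤ Q → Real.log Q ^ (2 : ℝ) ≤ T → T ≤ Real.log Q ^ A →
      (0.6044 : ℝ) * w.sonoFamilyZeroCount W Q T ≤ w.sonoFamilySimpleCriticalZeroCount W Q T ∧
      (0.6107 : ℝ) * w.sonoFamilyZeroCount W Q T ≤ w.sonoFamilyCriticalZeroCount W Q T
  /-- dhE-14 / Wu Thm 2 = `wu2019_theorem2` (its `∃ T₀` for each `g` is `T₀ g`). -/
  rowWu : ∀ g : ℝ → ℝ, Tendsto (fun T ↦ g T / Real.log T) atTop (𝓝 0) →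
    ∀ T : ℝ, T₀ g ≤ T → ∀ (q : ℕ) [NeZero q], Real.log q ≤ g T → ∀ χ : DirichletCharacter ℂ q,
      (0.4172 : ℝ) * (w.cisZeroCount q χ T : ℝ) ≤ w.wuCriticalZeroCount q χ T ∧
      (0.4074 : ℝ) * (w.cisZeroCount q χ T : ℝ) ≤ w.cisSimpleCriticalZeroCount q χ T

end ZeroWorld

/-- **`MenuInformalCritLineConsistent` (B-DH-W, the typed proportion rows of dhE-14; S-E-bd1-3 part 2).** There are threshold
functions `Q₀(Ψ, A)` (CIS), `Q₁(W, A)` (Sono), `T₀(g)` (Wu), chosen ONCE, such that for every modulus `D` with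
`log D ≥ 43 250` and every primitive quadratic `χ ≠ χ₀` mod `D` the (A)-world `world D χ` satisfies the critical-line informal
menu with those thresholds. [cite: Zhang2022LandauSiegel, §2 Assumption (A)] -/
def MenuInformalCritLineConsistent : Prop :=
  ∃ Q₀ Q₁ : (ℝ → ℝ) → ℝ → ℝ, ∃ T₀ : (ℝ → ℝ) → ℝ,
    ∀ (D : ℕ) [NeZero D] (χ : DirichletCharacter ℂ D), χ.IsPrimitive → χ.IsQuadratic → χ ≠ 1 →
      (43250 : ℝ) ≤ Real.log D → (world D χ).MenuInformalCritLine Q₀ Q₁ T₀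

/-! ## 3. Generic bookkeeping: weighted `finsum`s with finitely many non-zero weights -/

/-- Termwise comparison of two weighted `finsum`s whose weights vanish off a finite set:
`κ·Σᶠ c·B ≤ Σᶠ c·A` when `c ≥ 0` and `κ·B ≤ A` termwise. [folklore] -/
private theorem weighted_finsum_le {c A B : ℕ → ℝ} {κ : ℝ} (hc : ∀ k, 0 ≤ c k) (hAB : ∀ k, κ * B k ≤ A k)
    (s : Finset ℕ) (hs : ∀ k ∉ s, c k = 0) :
    κ * ∑ᶠ k, c k * B k ≤ ∑ᶠ k, c k * A k := by
  have hB : Function.support (fun k => c k * B k) ⊆ ↑s := by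
    intro k hk
    by_contra hks
    exact hk (by simp [hs k hks])
  have hA : Function.support (fun k => c k * A k) ⊆ ↑s := by
    intro k hk
    by_contra hks
    exact hk (by simp [hs k hks])
  rw [finsum_eq_sum_of_support_subset _ hB, finsum_eq_sum_of_support_subset _ hA, Finset.mul_sum]
  refine Finset.sum_le_sum fun k _ => ?_
  calc κ * (c k * B k) = c k * (κ * B k) := by ring
    _ ≤ c k * A k := mul_le_mul_of_nonneg_left (hAB k) (hc k)

/-- A weight supported in `[c₁, c₂]` vanishes at `(k+1)/Q` once `k ∉ range (⌊c₂ Q⌋₊ + 1)` (`Q > 0`). [folklore] -/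
private theorem weight_eq_zero_of_large {Ψ : ℝ → ℝ} {c₁ c₂ Q : ℝ} (hsupp : tsupport Ψ ⊆ Set.Icc c₁ c₂) (hQ : 0 < Q)
    {k : ℕ} (hk : k ∉ Finset.range (⌊c₂ * Q⌋₊ + 1)) : Ψ (((k + 1 : ℕ) : ℝ) / Q) = 0 := by
  apply image_eq_zero_of_notMem_tsupport
  intro hmem
  have h2 := (hsupp hmem).2
  rw [div_le_iff₀ hQ] at h2
  rw [Finset.mem_range, not_lt] at hk
  have hk' : (⌊c₂ * Q⌋₊ : ℝ) + 1 ≤ k := by exact_mod_cast hk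
  have hfl : c₂ * Q < (⌊c₂ * Q⌋₊ : ℝ) + 1 := Nat.lt_floor_add_one _
  push_cast at h2
  linarith

/-! ## 4. The (A)-world's slots: every critical-strip zero is a fence point or one of the real pair -/

section World

variable {D : ℕ} {χ : DirichletCharacter ℂ D}

/-- `1 ≤ conductor`. [cite: MontgomeryVaughan2007, §9.1] -/
theorem one_le_conductor_of_neZero {q : ℕ} [NeZero q] (ψ : DirichletCharacter ℂ q) : 1 ≤ ψ.conductor :=
  Nat.one_le_iff_ne_zero.2 (DirichletCharacter.conductor_ne_zero ψ)

/-- On the zeros of `W`, multiplicities are `1`: a sum of `mult` over a finset of zeros is its cardinality.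
[cite: Zhang2022LandauSiegel, §2 Assumption (A)] -/
theorem sum_mult_eq_card_of_isZero {q : ℕ} [NeZero q] (ψ : DirichletCharacter ℂ q) (s : Finset ℂ)
    (hs : ∀ ρ ∈ s, (world D χ).IsZero q ψ ρ) : ∑ ρ ∈ s, (world D χ).mult q ψ ρ = s.card := by
  rw [Finset.card_eq_sum_ones]
  exact Finset.sum_congr rfl fun ρ hρ => (isZero_world_iff_mult_eq_one χ).1 (hs ρ hρ)

/-- `N(T,χ)` of CIS over ANY world is the world's `stripCount` = `lfunctionZeroCount` read over the world (same set,
re-associated). [cite: ConreyIwaniecSoundararajan2011CriticalZeros, §1 (1.2) (definition of N(T,χ))] -/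
theorem cisZeroCount_eq_stripCount (w : ZeroWorld) (q : ℕ) (ψ : DirichletCharacter ℂ q) (T : ℝ) :
    w.cisZeroCount q ψ T = w.stripCount q ψ T := by
  have h : {ρ : ℂ | ρ ∈ w.nontrivialZeros q ψ ∧ |ρ.im| ≤ T} =
      {ρ : ℂ | w.IsZero q ψ ρ ∧ 0 < ρ.re ∧ ρ.re < 1 ∧ |ρ.im| ≤ T} := by
    ext ρ
    simp only [ZeroWorld.nontrivialZeros, Set.mem_setOf_eq, and_assoc]
  unfold ZeroWorld.cisZeroCount ZeroWorld.stripCount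
  rw [h]

variable (hL : (43250 : ℝ) ≤ Real.log D)
include hL

/-- In `W` a point of the exceptional pair is NOT on the critical line. [cite: Zhang2022LandauSiegel, §2 Assumption (A)] -/
theorem re_ne_half_of_mem_excPair {ρ : ℂ} (h : ρ ∈ excPair D) : ρ.re ≠ 1 / 2 := by
  have hb := half_lt_betaExc hL
  have hb' := one_sub_betaExc_lt_half hL
  rcases re_of_mem_excPair h with h1 | h1 <;> rw [h1] <;> linarith

/-- **The critical set of a slot of `W` is the fence below the height**: `{ρ : zero, 0 < Re ρ < 1, Re ρ = ½, |Im ρ| ≤ T}`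
= `fenceBelow (cond ψ) (fenceCount (cond ψ) T)` (`T ≥ 0`). [cite: BennettMartinOBryantRechnitzer2021, Theorem 1.1] -/
theorem world_critSet_eq {q : ℕ} [NeZero q] (ψ : DirichletCharacter ℂ q) {T : ℝ} (hT : 0 ≤ T) :
    {ρ : ℂ | ρ ∈ (world D χ).nontrivialZeros q ψ ∧ ρ.re = 1 / 2 ∧ |ρ.im| ≤ T} =
      ↑(fenceBelow ψ.conductor (fenceCount ψ.conductor T)) := by
  have hc := one_le_conductor_of_neZero ψ
  ext ρ
  rw [Finset.mem_coe, mem_fenceBelow_iff hc hT, Set.mem_setOf_eq]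
  unfold ZeroWorld.nontrivialZeros
  rw [Set.mem_setOf_eq, isZero_world_iff]
  constructor
  · rintro ⟨⟨hz | ⟨-, hp⟩, -, -⟩, hre, him⟩
    · exact ⟨hz, him⟩
    · exact absurd hre (re_ne_half_of_mem_excPair hL hp)
  · rintro ⟨hz, him⟩
    have hre := fence_re hz
    exact ⟨⟨Or.inl hz, by rw [hre]; norm_num, by rw [hre]; norm_num⟩, hre, him⟩

/-- The SIMPLE critical set of a slot of `W` is the same fence (every zero of `W` is simple).
[cite: BennettMartinOBryantRechnitzer2021, Theorem 1.1] -/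
theorem world_simpleCritSet_eq {q : ℕ} [NeZero q] (ψ : DirichletCharacter ℂ q) {T : ℝ} (hT : 0 ≤ T) :
    {ρ : ℂ | ρ ∈ (world D χ).nontrivialZeros q ψ ∧ ρ.re = 1 / 2 ∧ |ρ.im| ≤ T ∧ (world D χ).mult q ψ ρ = 1} =
      ↑(fenceBelow ψ.conductor (fenceCount ψ.conductor T)) := by
  rw [← world_critSet_eq hL ψ hT]
  ext ρ
  simp only [Set.mem_setOf_eq]
  constructor
  · rintro ⟨h1, h2, h3, -⟩
    exact ⟨h1, h2, h3⟩
  · rintro ⟨h1, h2, h3⟩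
    exact ⟨h1, h2, h3, (isZero_world_iff_mult_eq_one χ).1 h1.1⟩

/-- **Wu's `N₀(T,χ)` on a slot of `W` is `2·fenceCount (cond ψ) T`** (`T ≥ 0`). [cite: Wu2019TwistedMeanSquare, §1 (definition of N₀(T,χ))] -/
theorem world_wuCriticalZeroCount {q : ℕ} [NeZero q] (ψ : DirichletCharacter ℂ q) {T : ℝ} (hT : 0 ≤ T) :
    (world D χ).wuCriticalZeroCount q ψ T = 2 * fenceCount ψ.conductor T := by
  have hc := one_le_conductor_of_neZero ψ
  unfold ZeroWorld.wuCriticalZeroCount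
  rw [world_critSet_eq hL ψ hT, finsum_mem_coe_finset, sum_mult_eq_card_of_isZero ψ, card_fenceBelow hc]
  intro ρ hρ
  exact isZero_world_iff.2 (Or.inl ((mem_fenceBelow_iff hc hT).1 hρ).1)

/-- **CIS's `N₀′(T,χ)` on a slot of `W` is `2·fenceCount (cond ψ) T`** (`T ≥ 0`).
[cite: ConreyIwaniecSoundararajan2011CriticalZeros, §1 (definition of N₀′(T,χ))] -/
theorem world_cisSimpleCriticalZeroCount {q : ℕ} [NeZero q] (ψ : DirichletCharacter ℂ q) {T : ℝ} (hT : 0 ≤ T) :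
    (world D χ).cisSimpleCriticalZeroCount q ψ T = 2 * fenceCount ψ.conductor T := by
  unfold ZeroWorld.cisSimpleCriticalZeroCount
  rw [world_simpleCritSet_eq hL ψ hT, Set.ncard_coe_finset, card_fenceBelow (one_le_conductor_of_neZero ψ)]

omit hL in
/-- **CIS's `N(T,χ)` on a NON-induced slot of `W` is `2·fenceCount (cond ψ) T`** (`T ≥ 0`).
[cite: ConreyIwaniecSoundararajan2011CriticalZeros, §1 (1.2)] -/
theorem world_cisZeroCount_of_not_exc {q : ℕ} [NeZero q] {ψ : DirichletCharacter ℂ q} (hψ : ¬ IsExcSlot D χ q ψ)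
    {T : ℝ} (hT : 0 ≤ T) : (world D χ).cisZeroCount q ψ T = 2 * fenceCount ψ.conductor T := by
  rw [cisZeroCount_eq_stripCount, stripCount_world_of_not_exc χ hψ hT]

/-- **CIS's `N(T,χ)` on an INDUCED slot of `W` is `2·fenceCount (cond ψ) T + 2`** (`T ≥ 0`; the real pair counts).
[cite: ConreyIwaniecSoundararajan2011CriticalZeros, §1 (1.2)] -/
theorem world_cisZeroCount_of_exc {q : ℕ} [NeZero q] {ψ : DirichletCharacter ℂ q} (hψ : IsExcSlot D χ q ψ)
    {T : ℝ} (hT : 0 ≤ T) : (world D χ).cisZeroCount q ψ T = 2 * fenceCount ψ.conductor T + 2 := by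
  rw [cisZeroCount_eq_stripCount, stripCount_world_of_exc hL hψ hT]

omit hL in
/-- **Sono's dyadic window misses the real pair**: every zero of a slot of `W` with `T ≤ Im ρ < 2T` is a fence point,
hence on the line and simple; so Sono's three per-slot counts COINCIDE on `W` — here `N₀ = N`.
[cite: Sono2025, §1 (definitions of N, N₀, N₀′)] -/
theorem world_sonoCriticalZeroCount_eq {q : ℕ} [NeZero q] (ψ : DirichletCharacter ℂ q) (T : ℝ) :
    (world D χ).sonoCriticalZeroCount q ψ T = (world D χ).sonoZeroCount q ψ T := by
  have hset : {ρ : ℂ | ρ ∈ (world D χ).nontrivialZeros q ψ ∧ ρ.re = 1 / 2 ∧ T ≤ ρ.im ∧ ρ.im < 2 * T} =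
      {ρ : ℂ | ρ ∈ (world D χ).nontrivialZeros q ψ ∧ T ≤ ρ.im ∧ ρ.im < 2 * T} := by
    ext ρ
    simp only [Set.mem_setOf_eq]
    constructor
    · rintro ⟨h1, -, h3, h4⟩
      exact ⟨h1, h3, h4⟩
    · rintro ⟨h1, h3, h4⟩
      refine ⟨h1, ?_, h3, h4⟩
      -- a zero in the window is a fence point (the pair has `Im = 0`, impossible with `T ≤ 0 < 2T`)
      unfold ZeroWorld.nontrivialZeros at h1
      rw [Set.mem_setOf_eq, isZero_world_iff] at h1
      rcases h1 with ⟨hz | ⟨-, hp⟩, -, -⟩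
      · exact fence_re hz
      · exfalso
        have him := im_of_mem_excPair hp
        rw [him] at h3 h4
        linarith
  unfold ZeroWorld.sonoCriticalZeroCount ZeroWorld.sonoZeroCount
  rw [hset]

omit hL in
/-- … and `N₀′ = N` (Sono, dyadic window) on every slot of `W`. [cite: Sono2025, §1 (definitions of N, N₀, N₀′)] -/
theorem world_sonoSimpleCriticalZeroCount_eq {q : ℕ} [NeZero q] (ψ : DirichletCharacter ℂ q) (T : ℝ) :
    (world D χ).sonoSimpleCriticalZeroCount q ψ T = (world D χ).sonoZeroCount q ψ T := by
  have hc := one_le_conductor_of_neZero ψ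
  -- the window set
  set S : Set ℂ := {ρ : ℂ | ρ ∈ (world D χ).nontrivialZeros q ψ ∧ T ≤ ρ.im ∧ ρ.im < 2 * T} with hSdef
  -- every point of `S` is a zero on the fence: on the line and simple
  have hfence : ∀ ρ ∈ S, ρ ∈ fence ψ.conductor ∧ (world D χ).IsZero q ψ ρ := by
    intro ρ hρ
    rw [hSdef, Set.mem_setOf_eq] at hρ
    obtain ⟨h1, h3, h4⟩ := hρ
    unfold ZeroWorld.nontrivialZeros at h1
    rw [Set.mem_setOf_eq] at h1
    have hz := h1.1
    rw [isZero_world_iff] at h1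
    rcases h1 with ⟨hf | ⟨-, hp⟩, -, -⟩
    · exact ⟨hf, hz⟩
    · exfalso
      have him := im_of_mem_excPair hp
      rw [him] at h3 h4
      linarith
  -- the simple-critical window set IS `S`
  have hS' : {ρ : ℂ | ρ ∈ (world D χ).nontrivialZeros q ψ ∧ ρ.re = 1 / 2 ∧ T ≤ ρ.im ∧ ρ.im < 2 * T ∧
      (world D χ).mult q ψ ρ = 1} = S := by
    ext ρ
    rw [hSdef, Set.mem_setOf_eq, Set.mem_setOf_eq]
    constructor
    · rintro ⟨h1, -, h3, h4, -⟩
      exact ⟨h1, h3, h4⟩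
    · intro hρ
      obtain ⟨hf, hz⟩ := hfence ρ hρ
      exact ⟨hρ.1, fence_re hf, hρ.2.1, hρ.2.2, (isZero_world_iff_mult_eq_one χ).1 hz⟩
  -- `S` is finite (inside the fence box of height `2|T|`)
  have hTabs : 0 ≤ 2 * |T| := by positivity
  have hsub : S ⊆ fence ψ.conductor ∩ {ρ | |ρ.im| ≤ 2 * |T|} := by
    intro ρ hρ
    refine ⟨(hfence ρ hρ).1, ?_⟩
    rw [hSdef, Set.mem_setOf_eq] at hρ
    obtain ⟨-, h3, h4⟩ := hρ
    show |ρ.im| ≤ 2 * |T|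
    rw [abs_le]
    constructor
    · have : -|T| ≤ T := neg_abs_le T
      linarith
    · have : T ≤ |T| := le_abs_self T
      linarith
  have hfin : S.Finite := (fence_box_finite hc hTabs).subset hsub
  unfold ZeroWorld.sonoSimpleCriticalZeroCount ZeroWorld.sonoZeroCount
  rw [hS', ← hSdef, ← hfin.coe_toFinset, Set.ncard_coe_finset, finsum_mem_coe_finset,
    sum_mult_eq_card_of_isZero ψ]
  intro ρ hρ
  exact (hfence ρ (hfin.mem_toFinset.1 hρ)).2

/-! ### The one numerical fact: an induced slot's fence has at least two points below any height `T ≥ 1` -/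

omit hL in
/-- `log(2πe) ≤ 3` (`2π ≤ e²`). [cite: MontgomeryVaughan2007, §4.3] -/
theorem log_two_pi_e_le_three : Real.log (2 * Real.pi * Real.exp 1) ≤ 3 := by
  have hpos : 0 < 2 * Real.pi * Real.exp 1 := by positivity
  rw [Real.log_le_iff_le_exp hpos]
  have h3 : Real.exp 3 = Real.exp 1 * (Real.exp 1 * Real.exp 1) := by
    rw [← Real.exp_add, ← Real.exp_add]; norm_num
  rw [h3]
  have he := Real.exp_one_gt_d9
  have hpi := Real.pi_lt_d2
  have he0 : 0 < Real.exp 1 := Real.exp_pos 1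
  nlinarith

/-- **`fenceCount D T ≥ 2` for `T ≥ 1`** (`log D ≥ 43 250`): `F_D(T) = (T/π) log(DT/2πe) ≥ 43 247/π > 3`.
[cite: BennettMartinOBryantRechnitzer2021, Theorem 1.1] -/
theorem two_le_fenceCount_self {T : ℝ} (hT : 1 ≤ T) : 2 ≤ fenceCount D T := by
  have hD0 := cast_pos_of_hL hL
  have hT0 : 0 < T := by linarith
  have hden : 0 < 2 * Real.pi * Real.exp 1 := by positivity
  -- `log(DT/(2πe)) ≥ 43247`
  have hlog : 43247 ≤ Real.log ((D : ℝ) * T / (2 * Real.pi * Real.exp 1)) := by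
    rw [Real.log_div (by positivity) hden.ne', Real.log_mul hD0.ne' hT0.ne']
    have h1 := log_two_pi_e_le_three
    have h2 : 0 ≤ Real.log T := Real.log_nonneg hT
    linarith
  -- `rvmMain D T ≥ 43247/π ≥ 43247/4`
  have hrvm : (3 : ℝ) ≤ rvmMain D T := by
    unfold rvmMain
    have hpi : Real.pi ≤ 4 := Real.pi_le_four
    have hpi0 : 0 < Real.pi := Real.pi_pos
    have hTpi : 1 / 4 ≤ T / Real.pi := by
      rw [div_le_div_iff₀ (by norm_num) hpi0]; nlinarith
    calc (3 : ℝ) ≤ 1 / 4 * 43247 := by norm_num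
      _ ≤ T / Real.pi * Real.log ((D : ℝ) * T / (2 * Real.pi * Real.exp 1)) :=
          mul_le_mul hTpi hlog (by norm_num) (by positivity)
  unfold fenceCount
  apply Nat.le_floor
  push_cast
  linarith

/-! ## 5. The rows on the world -/

/-- **Row CIS Thm 1 on the world** with the UNIFORM threshold `Q₀ ≡ 3`: termwise `(14/25)·N ≤ N₀′` on every primitive slot
(`N₀′ = 2F`, `N = 2F` off the induced slots and `2F + 2` on them, where `F = fenceCount D T ≥ 2` since `T ≥ (log Q)⁶ ≥ 1`),
summed with the non-negative weights `Ψ(q/Q)/φ(q)` (finitely many non-zero). [cite: ConreyIwaniecSoundararajan2011CriticalZeros, Theorem 1 (1.5)] -/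
theorem world_rowCritLineCIS1 (hprim : χ.IsPrimitive) : ∀ Ψ : ℝ → ℝ, CISCriticalZeros.IsNonnegFamilyWeight Ψ →
    ∀ A : ℝ, 6 ≤ A → ∀ Q T : ℝ, (3 : ℝ) ≤ Q → Real.log Q ^ (6 : ℝ) ≤ T → T ≤ Real.log Q ^ A →
      (14 / 25 : ℝ) * (world D χ).cisFamilyZeroCount Ψ Q T ≤ (world D χ).cisFamilySimpleCriticalZeroCount Ψ Q T := by
  intro Ψ hΨ A _ Q T hQ hTlo _
  obtain ⟨-, hΨ0, c₁, c₂, -, hsupp⟩ := hΨ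
  have hQ0 : 0 < Q := by linarith
  -- `T ≥ 1`
  have hlogQ : 1 ≤ Real.log Q := by
    have h3 : Real.log 3 ≤ Real.log Q := Real.log_le_log (by norm_num) hQ
    have h13 : (1 : ℝ) < Real.log 3 := by
      rw [Real.lt_log_iff_exp_lt (by norm_num)]; linarith [Real.exp_one_lt_d9]
    linarith
  have hT1 : 1 ≤ T := le_trans (Real.one_le_rpow hlogQ (by norm_num)) hTlo
  have hT0 : 0 ≤ T := by linarith
  have hF := two_le_fenceCount_self hL hT1
  -- termwise inequality on every slot
  have hslot : ∀ (q : ℕ) [NeZero q] (ψ : DirichletCharacter ℂ q),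
      (14 / 25 : ℝ) * ((world D χ).cisZeroCount q ψ T : ℝ) ≤ ((world D χ).cisSimpleCriticalZeroCount q ψ T : ℝ) := by
    intro q _ ψ
    rw [world_cisSimpleCriticalZeroCount hL ψ hT0]
    by_cases hs : IsExcSlot D χ q ψ
    · rw [world_cisZeroCount_of_exc hL hs hT0, hs.conductor_eq hprim]
      have hF' : (2 : ℝ) ≤ fenceCount D T := by exact_mod_cast hF
      push_cast
      nlinarith
    · rw [world_cisZeroCount_of_not_exc hs hT0]
      push_cast
      have : (0 : ℝ) ≤ fenceCount ψ.conductor T := Nat.cast_nonneg _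
      nlinarith
  -- the family sums, termwise
  unfold ZeroWorld.cisFamilyZeroCount ZeroWorld.cisFamilySimpleCriticalZeroCount
  refine weighted_finsum_le (fun k => div_nonneg (hΨ0 _) (Nat.cast_nonneg _)) (fun k => ?_)
    (Finset.range (⌊c₂ * Q⌋₊ + 1)) (fun k hk => by rw [weight_eq_zero_of_large hsupp hQ0 hk, zero_div])
  haveI : NeZero (k + 1) := ⟨Nat.succ_ne_zero k⟩
  rw [Finset.mul_sum]
  exact Finset.sum_le_sum fun ψ _ => hslot (k + 1) ψ

omit hL in
/-- **Row Sono Thm 1.1 on the world** with the UNIFORM threshold `Q₁ ≡ 3` (any value works; this row needs no hypothesis on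
`D` at all): on every slot the dyadic window contains fence points only, so `N = N₀ = N₀′` slot by slot and
`𝒩 = 𝒩₀ = 𝒩₀′ ≥ 0`. [cite: Sono2025, Theorem 1.1] -/
theorem world_rowCritLineSono : ∀ W : ℝ → ℝ, SonoCriticalZeros.IsSonoWeight W → ∀ A : ℝ, 2 < A →
    ∀ Q T : ℝ, (3 : ℝ) ≤ Q → Real.log Q ^ (2 : ℝ) ≤ T → T ≤ Real.log Q ^ A →
      (0.6044 : ℝ) * (world D χ).sonoFamilyZeroCount W Q T ≤ (world D χ).sonoFamilySimpleCriticalZeroCount W Q T ∧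
      (0.6107 : ℝ) * (world D χ).sonoFamilyZeroCount W Q T ≤ (world D χ).sonoFamilyCriticalZeroCount W Q T := by
  intro W hW A _ Q T _ _ _
  obtain ⟨-, hW0, -⟩ := hW
  -- the three family counts coincide on `W`
  have h0 : (world D χ).sonoFamilyCriticalZeroCount W Q T = (world D χ).sonoFamilyZeroCount W Q T := by
    unfold ZeroWorld.sonoFamilyCriticalZeroCount ZeroWorld.sonoFamilyZeroCount
    congr 1
    funext k ψ
    rw [world_sonoCriticalZeroCount_eq (χ := χ)]
  have h0' : (world D χ).sonoFamilySimpleCriticalZeroCount W Q T = (world D χ).sonoFamilyZeroCount W Q T := by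
    unfold ZeroWorld.sonoFamilySimpleCriticalZeroCount ZeroWorld.sonoFamilyZeroCount
    congr 1
    funext k ψ
    rw [world_sonoSimpleCriticalZeroCount_eq (χ := χ)]
  -- and the common value is non-negative
  have hnn : 0 ≤ (world D χ).sonoFamilyZeroCount W Q T := by
    unfold ZeroWorld.sonoFamilyZeroCount SonoCriticalZeros.evenFamilySum
    exact finsum_nonneg fun k => mul_nonneg (hW0 _) (Finset.sum_nonneg fun ψ _ => Nat.cast_nonneg _)
  rw [h0, h0']
  constructor <;> nlinarith

/-- **Row Wu Thm 2 on the world** with the UNIFORM threshold `T₀ ≡ 1`: on a slot of `W`, `N₀ = N₀* = 2F` and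
`N = 2F` (non-induced) or `2F + 2` with `F = fenceCount D T ≥ 2` (induced, `T ≥ 1`), so `0.4172·N ≤ N₀` and `0.4074·N ≤ N₀*`.
[cite: Wu2019TwistedMeanSquare, Theorem 2] -/
theorem world_rowCritLineWu (hprim : χ.IsPrimitive) : ∀ g : ℝ → ℝ, Tendsto (fun T ↦ g T / Real.log T) atTop (𝓝 0) →
    ∀ T : ℝ, (1 : ℝ) ≤ T → ∀ (q : ℕ) [NeZero q], Real.log q ≤ g T → ∀ ψ : DirichletCharacter ℂ q,
      (0.4172 : ℝ) * ((world D χ).cisZeroCount q ψ T : ℝ) ≤ (world D χ).wuCriticalZeroCount q ψ T ∧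
      (0.4074 : ℝ) * ((world D χ).cisZeroCount q ψ T : ℝ) ≤ (world D χ).cisSimpleCriticalZeroCount q ψ T := by
  intro g _ T hT q _ _ ψ
  have hT0 : 0 ≤ T := by linarith
  rw [world_wuCriticalZeroCount hL ψ hT0, world_cisSimpleCriticalZeroCount hL ψ hT0]
  by_cases hs : IsExcSlot D χ q ψ
  · rw [world_cisZeroCount_of_exc hL hs hT0, hs.conductor_eq hprim]
    have hF' : (2 : ℝ) ≤ fenceCount D T := by exact_mod_cast two_le_fenceCount_self hL hT
    push_cast
    constructor <;> nlinarith
  · rw [world_cisZeroCount_of_not_exc hs hT0]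
    have : (0 : ℝ) ≤ fenceCount ψ.conductor T := Nat.cast_nonneg _
    push_cast
    constructor <;> nlinarith

end World

/-! ## 6. The certificate -/

/-- **`MenuInformalCritLineConsistent` HOLDS** — witnesses `Q₀ ≡ 3`, `Q₁ ≡ 3`, `T₀ ≡ 1`, chosen before `D`.
[cite: Zhang2022LandauSiegel, §2 Assumption (A)] -/
theorem menuInformalCritLineConsistent_holds : MenuInformalCritLineConsistent := by
  refine ⟨fun _ _ => 3, fun _ _ => 3, fun _ => 1, ?_⟩
  intro D _ χ hprim _ _ hL
  exact
    { rowCIS1 := world_rowCritLineCIS1 hL hprim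
      rowSono := world_rowCritLineSono
      rowWu := world_rowCritLineWu hL hprim }

/-- REF-E C2 probe: the proved theorem IS the certificate by name. [cite: Zhang2022LandauSiegel, §2 Assumption (A)] -/
example : MenuInformalCritLineConsistent := menuInformalCritLineConsistent_holds

end Literature.NumberTheory.LFunctions.Zhang2022.DH

end
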